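import Mathlib
import Summits.ABC.ABC.Statement
import HarnessLib

/-!
# Shape D: the exponent is a power of two or an odd prime (solo-blind seat, session 5)

Shape D of the first open support is `1 + p^m = 2^k q^n` (`p, q` odd primes).  We prove that either `m = 2^e`
(and then, if `e ≥ 1`, `k = 1`: the equation is `x² + 1 = 2 yⁿ`), or `m` is an odd prime and `p + 1 = 2^s` is a
Mersenne prime (and the equation is Nagell–Ljunggren at the base `-p`).  Ingredients: lifting the exponent for an odd
prime exponent over an arbitrary odd base (`pow_odd_prime_add_one_corner`, the general form of `mersenne_prime_corner`)
and the elementary fact `P^t + 1 ≠ 2^s` for `P ≥ 3` odd, `t ≥ 2`.  Companion of `SoloBlindShapeCExponent`.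

* `pow_odd_prime_add_one_corner` : `p^ℓ + 1 = 2^k q^n` (`p ≥ 3` odd, `q, ℓ` odd primes) ⇒ `q ∤ p + 1`, `p + 1 = 2^s`.
* `pow_add_one_ne_two_pow` : `P^t + 1 = 2^s` is impossible for `P ≥ 3` odd and `t ≥ 2`.
* `shapeD_exponent` : `p^m + 1 = 2^k q^n` (`p, q` odd primes, `m ≥ 1`) ⇒ `(∃ e, m = 2^e) ∨ (m` odd prime `∧ p + 1 = 2^s)`.
* `shapeD_even_exponent` : in the first case with `m` even, `k = 1`.
-/

namespace Summit.ABC.ABC.Theorems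

/-- **Odd-prime-exponent corner of shape D over an arbitrary odd base.** If `p ≥ 3` is odd, `q, ℓ` are odd primes and
`p^ℓ + 1 = 2^k q^n`, then `q ∤ p + 1`, so `p + 1` is a power of two. -/
theorem pow_odd_prime_add_one_corner {k n ℓ p q : ℕ} (hp : Odd p) (hp3 : 3 ≤ p) (hq : q.Prime) (hℓ : ℓ.Prime)
    (hq2 : q ≠ 2) (hℓ2 : ℓ ≠ 2) (h : p ^ ℓ + 1 = 2 ^ k * q ^ n) :
    ¬ q ∣ p + 1 ∧ ∃ s : ℕ, p + 1 = 2 ^ s := by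
  haveI := Fact.mk hq
  have hq3 : 3 ≤ q := by have := hq.two_le; omega
  have hℓodd : Odd ℓ := hℓ.odd_of_ne_two hℓ2
  obtain ⟨h', hℓh⟩ : ∃ h', ℓ = 2 * h' + 1 := hℓodd
  have hh1 : 1 ≤ h' := by have := hℓ.two_le; omega
  -- `S = 1 + p² + ⋯ + (p²)^(h'-1)`, `(p² - 1) S = p^(2h') - 1`
  set S := ∑ i ∈ Finset.range h', (p ^ 2) ^ i with hSdef
  have hp2le : 2 ≤ p ^ 2 := by nlinarith
  have hgeom : S = ((p ^ 2) ^ h' - 1) / (p ^ 2 - 1) := Nat.geomSum_eq hp2le h'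
  have hS : (p ^ 2 - 1) * S = (p ^ 2) ^ h' - 1 := by
    rw [hgeom, Nat.mul_div_cancel' (Nat.sub_one_dvd_pow_sub_one (p ^ 2) h')]
  have hS1 : 1 ≤ S := by
    have : ∑ i ∈ Finset.range 1, (p ^ 2) ^ i ≤ S :=
      Finset.sum_le_sum_of_subset (Finset.range_subset_range.mpr hh1)
    simpa using this
  -- the cofactor `Ψ = (p-1) p S + 1` with `(p+1) Ψ = p^ℓ + 1`
  set Ψ := (p - 1) * p * S + 1 with hΨdef
  have hΨ : (p + 1) * Ψ = 2 ^ k * q ^ n := by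
    rw [← h, hℓh, hΨdef]
    have h1 : 1 ≤ (p ^ 2) ^ h' := Nat.one_le_pow _ _ (by positivity)
    have h2 : 1 ≤ p ^ 2 := by omega
    have h3 : 1 ≤ p := by omega
    zify [h1, h2, h3] at hS ⊢
    linear_combination (p : ℤ) * hS
  have hΨodd : Ψ % 2 = 1 := by
    have h2 : 2 ∣ (p - 1) * p * S := by
      have : 2 ∣ p - 1 := by
        have := Nat.odd_iff.mp hp
        omega
      exact (this.mul_right p).mul_right S
    omega
  have hΨbig : p + 2 ≤ Ψ := by
    have h6 : (p - 1) * p * 1 ≤ (p - 1) * p * S := Nat.mul_le_mul_left _ hS1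
    rw [mul_one] at h6
    have h5 : p + 1 ≤ (p - 1) * p := by
      obtain ⟨t, rfl⟩ : ∃ t, p = t + 1 := ⟨p - 1, by omega⟩
      rw [Nat.add_sub_cancel]
      nlinarith
    omega
  have hΨ0 : Ψ ≠ 0 := by omega
  -- every prime factor of `Ψ` is `q`
  have hΨsupp : ∀ d : ℕ, d.Prime → d ∣ Ψ → d = q := by
    intro d hd hdΨ
    have : d ∣ 2 ^ k * q ^ n := hΨ ▸ hdΨ.mul_left (p + 1)
    rcases (Nat.Prime.dvd_mul hd).mp this with h2 | hqn
    · have := (Nat.prime_dvd_prime_iff_eq hd Nat.prime_two).mp (hd.dvd_of_dvd_pow h2)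
      subst this
      exfalso
      omega
    · exact (Nat.prime_dvd_prime_iff_eq hd hq).mp (hd.dvd_of_dvd_pow hqn)
  have hnot : ¬ q ∣ p + 1 := by
    intro hqp
    have hqnp : ¬ q ∣ p := by
      intro h'
      have : q ∣ 1 := (Nat.dvd_add_right h').mp hqp
      exact hq.one_lt.ne' (Nat.dvd_one.mp this)
    -- LTE: `v_q(p^ℓ + 1) = v_q(p + 1) + v_q(ℓ)`
    have hlte := padicValNat.pow_add_pow (hq.odd_of_ne_two hq2) (x := p) (y := 1) (by simpa using hqp) hqnp (hℓ.odd_of_ne_two hℓ2)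
    rw [one_pow, h] at hlte
    have hv2 : padicValNat q (2 ^ k) = 0 := by
      apply padicValNat.eq_zero_of_not_dvd
      intro h'
      have := (Nat.prime_dvd_prime_iff_eq hq Nat.prime_two).mp (hq.dvd_of_dvd_pow h')
      omega
    have hvn : padicValNat q (2 ^ k * q ^ n) = n := by
      rw [padicValNat.mul (by positivity) (by positivity), hv2, padicValNat.prime_pow, zero_add]
    have hvℓ : padicValNat q ℓ ≤ 1 := by
      by_cases hql : q = ℓ
      · subst hql; rw [padicValNat_self]
      · rw [padicValNat.eq_zero_of_not_dvd]
        · exact zero_le_one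
        · intro h'; exact hql ((Nat.prime_dvd_prime_iff_eq hq hℓ).mp h')
    have hvprod : padicValNat q (p + 1) + padicValNat q Ψ = n := by
      rw [← padicValNat.mul (by omega) hΨ0, hΨ, hvn]
    obtain ⟨j, hj⟩ : ∃ j, Ψ = q ^ j := ⟨_, Nat.eq_prime_pow_of_unique_prime_dvd hΨ0 (hΨsupp _)⟩
    have hjv : padicValNat q Ψ = j := by rw [hj, padicValNat.prime_pow]
    have hj1 : j ≤ 1 := by omega
    have hΨle : Ψ ≤ q := by
      rw [hj]
      calc q ^ j ≤ q ^ 1 := Nat.pow_le_pow_right hq.pos hj1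
        _ = q := pow_one q
    have hqle : q ≤ p + 1 := Nat.le_of_dvd (by omega) hqp
    omega
  refine ⟨hnot, ?_⟩
  have hp1supp : ∀ d : ℕ, d.Prime → d ∣ p + 1 → d = 2 := by
    intro d hd hdp
    have : d ∣ 2 ^ k * q ^ n := hΨ ▸ hdp.mul_right Ψ
    rcases (Nat.Prime.dvd_mul hd).mp this with h2 | hqn
    · exact (Nat.prime_dvd_prime_iff_eq hd Nat.prime_two).mp (hd.dvd_of_dvd_pow h2)
    · have := (Nat.prime_dvd_prime_iff_eq hd hq).mp (hd.dvd_of_dvd_pow hqn)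
      subst this
      exact absurd hdp hnot
  exact ⟨_, Nat.eq_prime_pow_of_unique_prime_dvd (by omega) (hp1supp _)⟩


/-- `P^t + 1 = 2^s` is impossible for `P ≥ 3` odd and `t ≥ 2` (the elementary case of Catalan's equation). -/
theorem pow_add_one_ne_two_pow {P t s : ℕ} (hP : Odd P) (hP3 : 3 ≤ P) (ht : 2 ≤ t) (h : P ^ t + 1 = 2 ^ s) :
    False := by
  have hPt : 9 ≤ P ^ t :=
    calc 9 = 3 ^ 2 := by norm_num
      _ ≤ P ^ 2 := Nat.pow_le_pow_left hP3 2
      _ ≤ P ^ t := Nat.pow_le_pow_right (by omega) ht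
  -- `s ≥ 2`, so `4 ∣ P^t + 1`
  have hs4 : 4 ∣ 2 ^ s := by
    rcases s with _ | _ | s
    · simp at h; omega
    · simp at h; omega
    · exact Dvd.intro (2 ^ s) (by ring)
  rw [← h] at hs4
  rcases Nat.even_or_odd t with ⟨u, rfl⟩ | hto
  · -- `t = 2u`: `P^t = (P^u)²` is `1 mod 4`
    have hsq : P ^ (u + u) % 4 = 1 := by
      rw [← two_mul, pow_mul', Nat.pow_mod]
      have hPu : Odd (P ^ u) := hP.pow
      have : P ^ u % 4 = 1 ∨ P ^ u % 4 = 3 := by obtain ⟨r, hr⟩ := hPu; omega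
      rcases this with h4 | h4 <;> simp [h4]
    omega
  · -- `t` odd `≥ 3`: the odd cofactor `Ψ = (P-1) P S + 1` of `P^t + 1` divides `2^s`
    obtain ⟨h', hth⟩ : ∃ h', t = 2 * h' + 1 := hto
    have hh1 : 1 ≤ h' := by omega
    set S := ∑ i ∈ Finset.range h', (P ^ 2) ^ i with hSdef
    have hP2le : 2 ≤ P ^ 2 := by nlinarith
    have hgeom : S = ((P ^ 2) ^ h' - 1) / (P ^ 2 - 1) := Nat.geomSum_eq hP2le h'
    have hS : (P ^ 2 - 1) * S = (P ^ 2) ^ h' - 1 := by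
      rw [hgeom, Nat.mul_div_cancel' (Nat.sub_one_dvd_pow_sub_one (P ^ 2) h')]
    have hS1 : 1 ≤ S := by
      have : ∑ i ∈ Finset.range 1, (P ^ 2) ^ i ≤ S :=
        Finset.sum_le_sum_of_subset (Finset.range_subset_range.mpr hh1)
      simpa using this
    set Ψ := (P - 1) * P * S + 1 with hΨdef
    have hΨ : (P + 1) * Ψ = 2 ^ s := by
      rw [← h, hth, hΨdef]
      have h1 : 1 ≤ (P ^ 2) ^ h' := Nat.one_le_pow _ _ (by positivity)
      have h2 : 1 ≤ P ^ 2 := by omega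
      have h3 : 1 ≤ P := by omega
      zify [h1, h2, h3] at hS ⊢
      linear_combination (P : ℤ) * hS
    have hΨodd : Ψ % 2 = 1 := by
      have h2 : 2 ∣ (P - 1) * P * S := by
        have : 2 ∣ P - 1 := by
          have := Nat.odd_iff.mp hP
          omega
        exact (this.mul_right P).mul_right S
      omega
    have hΨbig : 2 ≤ Ψ := by
      have h6 : 1 * 1 * 1 ≤ (P - 1) * P * S := Nat.mul_le_mul (Nat.mul_le_mul (by omega) (by omega)) hS1
      omega
    obtain ⟨i, -, hi⟩ := (Nat.dvd_prime_pow Nat.prime_two).mp (Dvd.intro_left _ hΨ)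
    rcases i with _ | i
    · simp at hi; omega
    · have : 2 ∣ Ψ := hi ▸ Dvd.intro (2 ^ i) (by ring)
      omega

/-- **Shape D: the exponent is a power of two or an odd prime.** If `p, q` are odd primes, `m ≥ 1` and
`p^m + 1 = 2^k q^n`, then `m = 2^e`, or `m` is an odd prime and `p + 1 = 2^s` (`p` is a Mersenne prime). -/
theorem shapeD_exponent {k m n p q : ℕ} (hp : p.Prime) (hq : q.Prime) (hp2 : p ≠ 2) (hq2 : q ≠ 2) (hm : 1 ≤ m)
    (h : p ^ m + 1 = 2 ^ k * q ^ n) :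
    (∃ e : ℕ, m = 2 ^ e) ∨ (m.Prime ∧ m ≠ 2 ∧ ∃ s : ℕ, p + 1 = 2 ^ s) := by
  have hp3 : 3 ≤ p := by have := hp.two_le; omega
  have hpodd : Odd p := hp.odd_of_ne_two hp2
  by_cases H : ∃ ℓ, ℓ.Prime ∧ ℓ ≠ 2 ∧ ℓ ∣ m
  · obtain ⟨ℓ, hℓ, hℓ2, t, rfl⟩ := H
    have ht : 1 ≤ t := by
      rcases t with _ | t
      · simp at hm
      · omega
    have h' : (p ^ t) ^ ℓ + 1 = 2 ^ k * q ^ n := by rw [← h, mul_comm, pow_mul]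
    have hP3 : 3 ≤ p ^ t :=
      calc 3 ≤ p := hp3
        _ = p ^ 1 := (pow_one p).symm
        _ ≤ p ^ t := Nat.pow_le_pow_right (by omega) ht
    obtain ⟨-, s, hs⟩ := pow_odd_prime_add_one_corner hpodd.pow hP3 hq hℓ hq2 hℓ2 h'
    rcases Nat.lt_or_ge t 2 with ht1 | ht2
    · have : t = 1 := by omega
      subst this
      exact Or.inr ⟨by simpa using hℓ, by simpa using hℓ2, s, by simpa using hs⟩
    · exact (pow_add_one_ne_two_pow hpodd hp3 ht2 hs).elim
  · push Not at H
    have hm2 : ∀ d : ℕ, d.Prime → d ∣ m → d = 2 := by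
      intro d hd hdm
      by_contra hne
      exact H d hd hne hdm
    exact Or.inl ⟨_, Nat.eq_prime_pow_of_unique_prime_dvd (by omega) (hm2 _)⟩

/-- In shape D with an even exponent the power of two is exactly `2`: `p^(2j) + 1 = 2^k q^n` (`p, q` odd) forces
`k = 1`, i.e. the equation is `x² + 1 = 2 yⁿ`. -/
theorem shapeD_even_exponent {k j n p q : ℕ} (hp : Odd p) (hq : Odd q) (h : p ^ (2 * j) + 1 = 2 ^ k * q ^ n) :
    k = 1 := by
  have hsq : p ^ (2 * j) % 4 = 1 := by
    rw [pow_mul, Nat.pow_mod]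
    have : p % 4 = 1 ∨ p % 4 = 3 := by obtain ⟨r, hr⟩ := hp; omega
    have h2 : p ^ 2 % 4 = 1 := by
      rw [Nat.pow_mod]; rcases this with h4 | h4 <;> rw [h4]
    rw [← Nat.pow_mod, Nat.pow_mod (p ^ 2), h2]
    simp
  have hqn : q ^ n % 2 = 1 := Nat.odd_iff.mp hq.pow
  rcases k with _ | _ | k
  · simp at h; omega
  · rfl
  · exfalso
    have : 4 ∣ p ^ (2 * j) + 1 := by
      rw [h]
      exact Dvd.intro (2 ^ k * q ^ n) (by ring)
    omega

end Summit.ABC.ABC.Theorems
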